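import Summits.NavierStokesRegularity.NavierStokesRegularity.Theorems.ExtremiserTransienceNearExtremalTransienceExtremiserLiouvilleConstantSpeedKKTTail
import Mathlib.MeasureTheory.Measure.Haar.NormedSpace
import HarnessLib

/-!
# Crux `ExtremiserTransience.NearExtremalTransience` (stmt-NavierStokesRegularity-21883), line `extremiser_liouville`,
# stub K1b — KKT tail condition, PROFILE FORM: every uniform tail limit of the rescaled vorticity is annihilated

`--supports stmt-NavierStokesRegularity-21883` (helper).  Author: prover seat `ns-el-k1b` (g4).  Consumer-facing form of
`residue_tail_pairing_tendsto_zero` (`…ConstantSpeedKKTTail`).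

* `integral_inner_curl_curl_rescale`: the change of variables
  `∫⟪curl v, curl φ_R⟫ dx = ∫⟪R² · (curl v)(R y), (curl Φ)(y)⟫ dy` (`φ_R = Φ(·/R)`, `R > 0`; Mathlib `Measure.integral_comp_smul`);
* `residue_tailProfile_pairing_eq_zero`: if, for the residue object `v` with far field `c`, the rescaled vorticity
  `y ↦ R²·(curl v)(R y)` converges UNIFORMLY on `tsupport (curl Φ)` (as `R → ∞`) to a continuous field `Ω`, where `Φ` is any
  smooth compactly supported divergence-free profile vanishing near `0` with `⟪c, Φ⟫ ≡ 0`, then **`∫⟪Ω, curl Φ⟫ = 0`**.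

So a putative homogeneous tail `v − c ≈ U(x̂)/|x|` of the residue object (the only regime left open by the decay-gap Liouville)
must have `Ω = curl(U(x̂)/|x|)` weakly curl-free against all `c`-horizontal solenoidal profiles — the record's condition (C)
(dipole twist); the explicit non-extremal example has `Ω₃ ∝ |cos θ|(3cos²θ − 1)/|x|²` and fails it.

WHAT THIS IS NOT: K1b is NOT proved (no tail expansion of the residue object is established here); nothing here proves NS
regularity. [folklore]
-/

noncomputable section

open Set Filter Topology MeasureTheory Metric Function
open scoped ENNReal NNReal Topology InnerProductSpace RealInnerProductSpace ContDiff
open Literature.Analysis.FluidPDE Literature.Analysis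

namespace Summit.NavierStokesRegularity.NavierStokesRegularity.Theorems

-- the problem directory repeats the summit name (`NavierStokesRegularity/NavierStokesRegularity`)
set_option linter.dupNamespace false

namespace ExtremiserLiouville

variable {v Φ : EuclideanSpace ℝ (Fin 3) → EuclideanSpace ℝ (Fin 3)} {c : EuclideanSpace ℝ (Fin 3)}

/-- **Change of variables**: `∫⟪curl v(x), curl φ_R(x)⟫dx = ∫⟪R²·(curl v)(R y), (curl Φ)(y)⟫dy` for `R > 0`. [folklore] -/
theorem integral_inner_curl_curl_rescale (hΦ : Differentiable ℝ Φ) {R : ℝ} (hR : 0 < R) :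
    (∫ x, ⟪curl v x, curl (fun y => Φ (R⁻¹ • y)) x⟫) =
      ∫ y, ⟪(R ^ 2) • curl v (R • y), curl Φ y⟫ := by
  have hR0 : R ≠ 0 := hR.ne'
  -- write the integrand as `g (R⁻¹ • x)` with `g y = R⁻¹ ⟪curl v (R y), curl Φ y⟫`
  set g : EuclideanSpace ℝ (Fin 3) → ℝ := fun y => R⁻¹ * ⟪curl v (R • y), curl Φ y⟫ with hg
  have h1 : (fun x => ⟪curl v x, curl (fun y => Φ (R⁻¹ • y)) x⟫) = fun x => g (R⁻¹ • x) := by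
    funext x
    rw [curl_rescale hΦ, inner_smul_right, hg]
    simp only [smul_smul, mul_inv_cancel₀ hR0, one_smul]
  rw [h1, Measure.integral_comp_smul volume g R⁻¹, finrank_euclideanSpace, Fintype.card_fin, inv_pow, inv_inv,
    abs_of_pos (pow_pos hR 3), hg, ← integral_smul]
  refine integral_congr_ae (Eventually.of_forall fun y => ?_)
  simp only [smul_eq_mul, inner_smul_left, RCLike.conj_to_real]
  field_simp

/-- **KKT TAIL CONDITION, profile form.**  For the residue object (hypotheses of `residue_tail_pairing_tendsto_zero`) and a
`c`-horizontal solenoidal profile `Φ ∈ C_c^∞` vanishing on `B(0, r₀)`: if `R²·(curl v)(R·) → Ω` uniformly on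
`tsupport (curl Φ)` as `R → ∞`, with `Ω` continuous, then `∫⟪Ω, curl Φ⟫ = 0`. [folklore] -/
theorem residue_tailProfile_pairing_eq_zero
    (hv : ContDiff ℝ ∞ v) (hdiv : VectorCalculus.IsDivFree v) {M B : ℝ} (hMpos : 0 < M)
    (hM : ∀ x, ‖v x‖ = M) (hB : ∀ x, ‖fderiv ℝ v x‖ ≤ B)
    (h1 : ∫⁻ x, ‖iteratedFDeriv ℝ 1 v x‖ₑ ^ 2 < ⊤) (h2 : ∫⁻ x, ‖iteratedFDeriv ℝ 2 v x‖ₑ ^ 2 < ⊤)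
    (hpos : 0 < M * Real.sqrt (∫ x, ‖curl v x‖ ^ 2) * Real.sqrt (∫ x, frobeniusNormSq (fderiv ℝ (curl v) x)))
    (hatt : |∫ x, ⟪curl v x, fderiv ℝ v x (curl v x)⟫| = (sInf {κ : ℝ | (∀ (v : EuclideanSpace ℝ (Fin 3) → EuclideanSpace ℝ (Fin 3)) (M B : ℝ), ContDiff ℝ (⊤ : ℕ∞) v → Literature.Analysis.FluidPDE.VectorCalculus.IsDivFree v → (∀ x, ‖v x‖ ≤ M) → (∀ x, ‖fderiv ℝ v x‖ ≤ B) → (∫⁻ x, ‖iteratedFDeriv ℝ 0 v x‖ₑ ^ 2 < ⊤) → (∫⁻ x, ‖iteratedFDeriv ℝ 1 v x‖ₑ ^ 2 < ⊤) → (∫⁻ x, ‖iteratedFDeriv ℝ 2 v x‖ₑ ^ 2 < ⊤) → |∫ x, ⟪Literature.Analysis.FluidPDE.curl v x, fderiv ℝ v x (Literature.Analysis.FluidPDE.curl v x)⟫_ℝ| ≤ κ * M * Real.sqrt (∫ x, ‖Literature.Analysis.FluidPDE.curl v x‖ ^ 2) * Real.sqrt (∫ x, Literature.Analysis.FluidPDE.frobeniusNormSq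 (fderiv ℝ (Literature.Analysis.FluidPDE.curl v) x)))}) * M * Real.sqrt (∫ x, ‖curl v x‖ ^ 2) * Real.sqrt (∫ x, frobeniusNormSq (fderiv ℝ (curl v) x)))
    (hfar : Tendsto (fun x => v x - c) (cocompact (EuclideanSpace ℝ (Fin 3))) (𝓝 0))
    (hΦ : ContDiff ℝ ∞ Φ) (hΦc : HasCompactSupport Φ) (hΦdiv : VectorCalculus.IsDivFree Φ) {r₀ : ℝ} (hr₀ : 0 < r₀)
    (hΦ0 : ∀ y, ‖y‖ < r₀ → Φ y = 0) (hcΦ : ∀ y, ⟪c, Φ y⟫ = 0)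
    {Ω : EuclideanSpace ℝ (Fin 3) → EuclideanSpace ℝ (Fin 3)} (hΩ : Continuous Ω)
    (hconv : TendstoUniformlyOn (fun (R : ℝ) (y : EuclideanSpace ℝ (Fin 3)) => (R ^ 2) • curl v (R • y)) Ω atTop
      (tsupport (curl Φ))) :
    ∫ y, ⟪Ω y, curl Φ y⟫ = 0 := by
  have hΦd : Differentiable ℝ Φ := hΦ.differentiable (by simp)
  have hcurlΦ : Continuous (curl Φ) := continuous_curl (hΦ.of_le (by norm_cast))
  have hcurlΦc : HasCompactSupport (curl Φ) := by
    rw [curl_eq_curlCLM_comp]; exact (hΦc.fderiv (𝕜 := ℝ)).comp_left (map_zero _)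
  have hcv : Continuous (curl v) := continuous_curl (hv.of_le (by norm_cast))
  -- the limit along `R → ∞` of the rescaled pairings is `∫⟪Ω, curl Φ⟫`
  set T : ℝ → ℝ := fun R => ∫ y, ⟪(R ^ 2) • curl v (R • y), curl Φ y⟫ with hT
  have hnorm_int : Integrable (fun y => ‖curl Φ y‖) volume :=
    (hcurlΦ.norm).integrable_of_hasCompactSupport hcurlΦc.norm
  have hlim : Tendsto T atTop (𝓝 (∫ y, ⟪Ω y, curl Φ y⟫)) := by
    rw [Metric.tendsto_atTop]
    intro ε hε
    set I : ℝ := ∫ y, ‖curl Φ y‖ with hI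
    have hI0 : 0 ≤ I := integral_nonneg fun y => norm_nonneg _
    have hη : 0 < ε / (2 * (I + 1)) := by positivity
    obtain ⟨N, hN⟩ := eventually_atTop.1 ((Metric.tendstoUniformlyOn_iff.1 hconv) _ hη)
    refine ⟨N, fun R hR => ?_⟩
    have hptw : ∀ y, ‖⟪(R ^ 2) • curl v (R • y), curl Φ y⟫ - ⟪Ω y, curl Φ y⟫‖ ≤ ε / (2 * (I + 1)) * ‖curl Φ y‖ := by
      intro y
      rw [← inner_sub_left, Real.norm_eq_abs]
      by_cases hy : y ∈ tsupport (curl Φ)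
      · have hd := hN R hR y hy
        rw [dist_eq_norm, ← norm_neg, neg_sub] at hd
        exact (abs_real_inner_le_norm _ _).trans (mul_le_mul_of_nonneg_right hd.le (norm_nonneg _))
      · rw [image_eq_zero_of_notMem_tsupport hy, inner_zero_right, abs_zero, norm_zero, mul_zero]
    have hi1 : Integrable (fun y => ⟪(R ^ 2) • curl v (R • y), curl Φ y⟫) volume := by
      refine Continuous.integrable_of_hasCompactSupport ?_ ?_
      · exact ((hcv.comp (continuous_const_smul R)).const_smul (R ^ 2)).inner hcurlΦ
      · exact hcurlΦc.mono fun y hy => by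
          contrapose! hy; simp only [mem_support, not_not] at hy; simp [hy]
    have hi2 : Integrable (fun y => ⟪Ω y, curl Φ y⟫) volume := by
      refine Continuous.integrable_of_hasCompactSupport (hΩ.inner hcurlΦ) ?_
      exact hcurlΦc.mono fun y hy => by
        contrapose! hy; simp only [mem_support, not_not] at hy; simp [hy]
    rw [dist_eq_norm, hT]
    simp only
    rw [← integral_sub hi1 hi2]
    calc ‖∫ y, (⟪(R ^ 2) • curl v (R • y), curl Φ y⟫ - ⟪Ω y, curl Φ y⟫)‖
        ≤ ∫ y, ε / (2 * (I + 1)) * ‖curl Φ y‖ :=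
          norm_integral_le_of_norm_le (hnorm_int.const_mul _) (Eventually.of_forall hptw)
      _ = ε / (2 * (I + 1)) * I := by rw [integral_const_mul]
      _ < ε := by
          rw [div_mul_eq_mul_div, div_lt_iff₀ (by positivity)]
          nlinarith
  -- the same pairings are `a₁(φ_R) → 0`
  have hzero : Tendsto T atTop (𝓝 0) := by
    have h := residue_tail_pairing_tendsto_zero hv hdiv hMpos hM hB h1 h2 hpos hatt hfar hΦ hΦc hΦdiv hr₀ hΦ0 hcΦ
    refine h.congr' ?_
    filter_upwards [eventually_gt_atTop (0 : ℝ)] with R hR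
    rw [hT]
    exact integral_inner_curl_curl_rescale hΦd hR
  exact tendsto_nhds_unique hlim hzero

end ExtremiserLiouville

end Summit.NavierStokesRegularity.NavierStokesRegularity.Theorems

end
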